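import Mathlib
import HarnessLib

/-!
# BalabanUVNodes ∕ N15 — THE KING-MODEL RUNG (PART Ϝ-i, engine): LATTICE RIEMANN SUMS ON `ℝ^ι` WITH AN ANISOTROPIC MESH —
# `Σ_{k ∈ ℤ^ι} (Π_i ℓ_i)·c(k) = ∫ (step function)`, AND `→ ∫ F` UNDER AN INTEGRABLE ENVELOPE (dominated convergence); the continuous case with a product envelope
# (Track A, DAG node N15 = NE2; FAN-OUT v1.1 §N15 s3 «KING-MODEL RUNG»; the analytic engine of the thermodynamic limit of the block-smeared two-point function, part Ϝ-j)

HONEST FRAMING.  Count-neutral (cell `pub-ymgap`, seat `pub-ymgap-dag-n15-e` g33; `--supports stmt-QuantumFields-27366 --as helper` = K3⁸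
`SpineGivenEndpointR13SepCoPHV`).  Pure real analysis (folklore): the coordinatewise-meshed (ANISOTROPIC `ℓ : ι → ℝ`) generalisation, on the plain product `ι → ℝ`, of the
tree's engines `Literature/…/Federbush1986/LatticeRiemannSums` (`E4`, mesh `ℓ`) and `Literature/…/BalabanJaffe1986/BJ86LatticeRiemannSums` (`EuclideanSpace ℝ (Fin d)`, mesh `ℓ`)
— same proofs, `ℓ^d ↦ Π_i ℓ_i`; the anisotropy is what the rectangular unit tori `Π ℤ∕M_ν` of part Ϝ-j need (mesh `2π∕M_ν` per coordinate), the window-majorant form of the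
continuous case is new plumbing.  Used in part Ϝ-j for the momentum grids
`(2π∕M_ν)ℤ` of the unit tori `Π ℤ∕M_ν` of [King1986] (C. King, Commun. Math. Phys. **102** (1986) 649–677).  NOT a node discharge (N15 is booked through n15-a's
knit, untouched here); nothing Bałaban ∕ continuum-Yang–Mills ∕ ℝ⁴ ∕ OS ∕ mass-gap ∕ Clay.  0 `sorry`; standard axioms; FOUR plumbing definitions (`floorIdx`, `latBox`,
`cornerPt`, `stepFun`).

THE MATHEMATICS.  For a mesh `ℓ : ι → ℝ_{>0}` the half-open boxes `Π_i [ℓ_ik_i, ℓ_i(k_i+1))`, `k ∈ ℤ^ι`, partition `ℝ^ι`, each of volume `Π_iℓ_i`; the step function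
`x ↦ c(⌊x∕ℓ⌋)` has `∫ = Σ_k (Πℓ)c(k)` when integrable (`integral_tsum`); if along a sequence of meshes the step functions converge pointwise to `F` under an integrable
envelope `G`, then `Σ_k (Πℓ_n)c_n(k) → ∫F` (Lebesgue).  For `c_n(k) = h(ℓ_n ⊙ k)` with `h` continuous this is pointwise convergence at every `x` (`ℓ_n⌊x∕ℓ_n⌋ → x` when
`ℓ_n → 0` coordinatewise); a PRODUCT envelope `|h(y)| ≤ Π_i e(y_i)` with a window majorant `e(s) ≤ E(t)` for `|s − t| ≤ δ`, `E` integrable on `ℝ`, gives the domination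
by `Π_i E(x_i)` (integrable on `ℝ^ι` by Fubini, `Integrable.fintype_prod`).

WHAT THIS FILE PROVES (kernel).  §1 `floorIdx`, `latBox`, `cornerPt`, `stepFun`, `measurable_floorIdx`, `mem_latBox_iff`, `latBox_eq_pi`, `measurableSet_latBox`, ★ `volume_latBox`
(`= Π_iℓ_i`).  §2 `measurable_stepFun`, `stepFun_eq_tsum_indicator`, `lintegral_enorm_stepFun`, ★★ **`integral_stepFun`** (`∫ step = Σ_k (Πℓ)c(k)`).  §3 ★★★
**`tendsto_latticeSum_of_dominated`**.  §4 `abs_sub_cornerPt_le` (`|x_i − ℓ_i⌊x_i∕ℓ_i⌋| ≤ ℓ_i`), `tendsto_cornerPt`, `integrable_prodEnvelope`, ★★★ **`tendsto_latticeSum_continuous`**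
(continuous `h`, product envelope `C·Π_i e(y_i)` with a window majorant).

HONEST SCOPE.  Folklore measure theory; no physics.  N15 untouched; counts unmoved.  Locator for the use: [King1986] Thm 2.1 (2.22)–(2.23) p.654 (finite volume;
the infinite-volume step is part Ϝ-j's, in the free model only).
-/

noncomputable section

open MeasureTheory Filter Set
open scoped Topology BigOperators ENNReal

namespace Summit.QuantumFields.YangMills.BalabanUVNodes.N15KingModelRung.LatticeRiemann

variable {ι : Type*} [Fintype ι]

/-! ## §1 Anisotropic lattice boxes and their volume -/

/-- The index `⌊x∕ℓ⌋ ∈ ℤ^ι` (coordinatewise) of the half-open box containing `x`. [folklore] -/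
def floorIdx (ℓ : ι → ℝ) (x : ι → ℝ) : ι → ℤ := fun i => ⌊x i / ℓ i⌋

/-- The half-open box `Π_i [ℓ_ik_i, ℓ_i(k_i + 1))`. [folklore] -/
def latBox (ℓ : ι → ℝ) (b : ι → ℤ) : Set (ι → ℝ) := {x | ∀ i, ℓ i * b i ≤ x i ∧ x i < ℓ i * (b i + 1)}

/-- The lattice point `ℓ ⊙ k` (lower corner of `latBox ℓ k`). [folklore] -/
def cornerPt (ℓ : ι → ℝ) (b : ι → ℤ) : ι → ℝ := fun i => ℓ i * b i

/-- The box-step function with value `c k` on `latBox ℓ k`. [folklore] -/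
def stepFun (ℓ : ι → ℝ) (c : (ι → ℤ) → ℝ) : (ι → ℝ) → ℝ := fun x => c (floorIdx ℓ x)

variable {ℓ : ι → ℝ} {b : ι → ℤ} {c : (ι → ℤ) → ℝ}

omit [Fintype ι] in
/-- `⌊x∕ℓ⌋` is measurable. [folklore] -/
theorem measurable_floorIdx (ℓ : ι → ℝ) : Measurable (floorIdx ℓ) := by
  refine measurable_pi_iff.2 fun i => ?_
  have h1 : Measurable fun x : ι → ℝ => x i / ℓ i := by fun_prop
  exact Int.measurable_floor.comp h1

omit [Fintype ι] in
/-- `x ∈ latBox ℓ k ↔ ⌊x∕ℓ⌋ = k` (`ℓ > 0`). [folklore] -/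
theorem mem_latBox_iff (hℓ : ∀ i, 0 < ℓ i) {x : ι → ℝ} : x ∈ latBox ℓ b ↔ floorIdx ℓ x = b := by
  simp only [latBox, Set.mem_setOf_eq, floorIdx, funext_iff, Int.floor_eq_iff]
  refine forall_congr' fun i => ?_
  rw [le_div_iff₀ (hℓ i), div_lt_iff₀ (hℓ i)]
  constructor <;> rintro ⟨h1, h2⟩ <;> constructor <;> linarith

omit [Fintype ι] in
/-- The box as a coordinate box. [folklore] -/
theorem latBox_eq_pi (ℓ : ι → ℝ) (b : ι → ℤ) : latBox ℓ b = Set.univ.pi fun i => Ico (ℓ i * b i) (ℓ i * (b i + 1)) := by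
  ext x
  simp [latBox, Set.mem_pi]

/-- Lattice boxes are measurable. [folklore] -/
theorem measurableSet_latBox : MeasurableSet (latBox ℓ b) := by
  rw [latBox_eq_pi]
  exact MeasurableSet.univ_pi fun i => measurableSet_Ico

/-- ★ `vol(latBox ℓ k) = Π_i ℓ_i` (`ℓ ≥ 0`). [folklore] -/
theorem volume_latBox (hℓ : ∀ i, 0 ≤ ℓ i) (b : ι → ℤ) : volume (latBox ℓ b) = ENNReal.ofReal (∏ i, ℓ i) := by
  rw [latBox_eq_pi, Real.volume_pi_Ico]
  have : ∀ i : ι, ℓ i * ((b i : ℝ) + 1) - ℓ i * (b i : ℝ) = ℓ i := fun i => by ring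
  simp only [this]
  rw [ENNReal.ofReal_prod_of_nonneg fun i _ => hℓ i]

/-! ## §2 The integral of a box-step function is the lattice sum -/

/-- Box-step functions are measurable. [folklore] -/
theorem measurable_stepFun : Measurable (stepFun ℓ c) :=
  (measurable_of_countable c).comp (measurable_floorIdx ℓ)

omit [Fintype ι] in
/-- A box-step function is the sum of the indicators of its boxes. [folklore] -/
theorem stepFun_eq_tsum_indicator (hℓ : ∀ i, 0 < ℓ i) (x : ι → ℝ) :
    stepFun ℓ c x = ∑' b, (latBox ℓ b).indicator (fun _ => c b) x := by
  rw [tsum_eq_single (floorIdx ℓ x)]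
  · rw [indicator_of_mem ((mem_latBox_iff hℓ).2 rfl)]
    rfl
  · intro b hb
    exact indicator_of_notMem (fun hx => hb ((mem_latBox_iff hℓ).1 hx).symm) _

/-- `∫⁻ ‖step‖ₑ = Σ_k ‖c k‖ₑ·(Πℓ)`. [folklore] -/
theorem lintegral_enorm_stepFun (hℓ : ∀ i, 0 < ℓ i) :
    ∫⁻ x, ‖stepFun ℓ c x‖ₑ = ∑' b, ‖c b‖ₑ * ENNReal.ofReal (∏ i, ℓ i) := by
  have h : ∀ x, (‖stepFun ℓ c x‖ₑ : ℝ≥0∞) =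
      ∑' b, (latBox ℓ b).indicator (fun _ => (‖c b‖ₑ : ℝ≥0∞)) x := by
    intro x
    rw [tsum_eq_single (floorIdx ℓ x)]
    · rw [indicator_of_mem ((mem_latBox_iff hℓ).2 rfl)]
      rfl
    · intro b hb
      exact indicator_of_notMem (fun hx => hb ((mem_latBox_iff hℓ).1 hx).symm) _
  simp_rw [h]
  rw [lintegral_tsum fun b => (measurable_const.indicator measurableSet_latBox).aemeasurable]
  congr 1
  ext b
  rw [lintegral_indicator_const measurableSet_latBox, volume_latBox (fun i => (hℓ i).le)]

/-- ★★ **The integral of an integrable box-step function is the lattice sum `Σ_k (Π_iℓ_i)·c(k)`.** [folklore] -/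
theorem integral_stepFun (hℓ : ∀ i, 0 < ℓ i) (hint : Integrable (stepFun ℓ c)) :
    ∫ x, stepFun ℓ c x = ∑' b, (∏ i, ℓ i) * c b := by
  have hℓ0 : 0 ≤ ∏ i, ℓ i := Finset.prod_nonneg fun i _ => (hℓ i).le
  have hae : ∀ b, AEStronglyMeasurable (fun x => (latBox ℓ b).indicator (fun _ => c b) x) volume :=
    fun b => aestronglyMeasurable_const.indicator measurableSet_latBox
  have hlin : ∀ b, ∫⁻ x, ‖(latBox ℓ b).indicator (fun _ => c b) x‖ₑ = ‖c b‖ₑ * ENNReal.ofReal (∏ i, ℓ i) := by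
    intro b
    have : ∀ x, ‖(latBox ℓ b).indicator (fun _ => c b) x‖ₑ =
        (latBox ℓ b).indicator (fun _ => (‖c b‖ₑ : ℝ≥0∞)) x := by
      intro x
      by_cases hx : x ∈ latBox ℓ b <;> simp [hx]
    simp_rw [this]
    rw [lintegral_indicator_const measurableSet_latBox, volume_latBox (fun i => (hℓ i).le)]
  have hfin : ∑' b, ∫⁻ x, ‖(latBox ℓ b).indicator (fun _ => c b) x‖ₑ ≠ ∞ := by
    simp_rw [hlin]
    rw [← lintegral_enorm_stepFun hℓ]
    exact hint.hasFiniteIntegral.ne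
  have hfun : (fun x => stepFun ℓ c x) = fun x => ∑' b, (latBox ℓ b).indicator (fun _ => c b) x :=
    funext (stepFun_eq_tsum_indicator hℓ)
  rw [hfun, integral_tsum hae hfin]
  congr 1
  ext b
  rw [integral_indicator_const _ measurableSet_latBox, measureReal_def, volume_latBox (fun i => (hℓ i).le) b,
    ENNReal.toReal_ofReal hℓ0, smul_eq_mul]

/-! ## §3 Dominated convergence of lattice sums -/

/-- ★★★ **Lattice sums converge to the integral under an integrable envelope**: if the box-step functions `x ↦ c_n(⌊x∕ℓ_n⌋)` converge pointwise to `F` and are dominated by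
an integrable `G`, then `Σ_k (Π_iℓ_{n,i})c_n(k) → ∫F`. [folklore] -/
theorem tendsto_latticeSum_of_dominated (ℓ : ℕ → ι → ℝ) (hℓ : ∀ n i, 0 < ℓ n i) (c : ℕ → (ι → ℤ) → ℝ)
    (F G : (ι → ℝ) → ℝ) (hG : Integrable G) (hdom : ∀ n x, |c n (floorIdx (ℓ n) x)| ≤ G x)
    (hlim : ∀ x, Tendsto (fun n => c n (floorIdx (ℓ n) x)) atTop (𝓝 (F x))) :
    Tendsto (fun n => ∑' b, (∏ i, ℓ n i) * c n b) atTop (𝓝 (∫ x, F x)) := by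
  have hmeas : ∀ n, AEStronglyMeasurable (stepFun (ℓ n) (c n)) volume :=
    fun n => measurable_stepFun.aestronglyMeasurable
  have hbd : ∀ n, ∀ᵐ x ∂volume, ‖stepFun (ℓ n) (c n) x‖ ≤ G x :=
    fun n => Eventually.of_forall fun x => by rw [Real.norm_eq_abs]; exact hdom n x
  have hint : ∀ n, Integrable (stepFun (ℓ n) (c n)) := fun n => hG.mono' (hmeas n) (hbd n)
  have hconv := tendsto_integral_of_dominated_convergence G hmeas hG hbd (Eventually.of_forall hlim)
  exact Tendsto.congr (fun n => integral_stepFun (hℓ n) (hint n)) hconv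

/-! ## §4 The continuous case with a product envelope -/

omit [Fintype ι] in
/-- `|x_i − ℓ_i⌊x_i∕ℓ_i⌋| ≤ ℓ_i` (`ℓ_i > 0`). [folklore] -/
theorem abs_sub_cornerPt_le (hℓ : ∀ i, 0 < ℓ i) (x : ι → ℝ) (i : ι) : |x i - cornerPt ℓ (floorIdx ℓ x) i| ≤ ℓ i := by
  simp only [cornerPt, floorIdx]
  have h1 : (⌊x i / ℓ i⌋ : ℝ) ≤ x i / ℓ i := Int.floor_le _
  have h2 : x i / ℓ i < (⌊x i / ℓ i⌋ : ℝ) + 1 := Int.lt_floor_add_one _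
  rw [div_lt_iff₀ (hℓ i)] at h2
  rw [le_div_iff₀ (hℓ i)] at h1
  rw [abs_le]
  constructor <;> nlinarith [hℓ i]

omit [Fintype ι] in
/-- Along meshes `ℓ_n → 0` (coordinatewise) the lattice points `ℓ_n⌊x∕ℓ_n⌋` converge to `x`. [folklore] -/
theorem tendsto_cornerPt (ℓ : ℕ → ι → ℝ) (hℓ : ∀ n i, 0 < ℓ n i) (hℓ0 : ∀ i, Tendsto (fun n => ℓ n i) atTop (𝓝 0)) (x : ι → ℝ) :
    Tendsto (fun n => cornerPt (ℓ n) (floorIdx (ℓ n) x)) atTop (𝓝 x) := by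
  rw [tendsto_pi_nhds]
  intro i
  have h0 : Tendsto (fun n => x i - cornerPt (ℓ n) (floorIdx (ℓ n) x) i) atTop (𝓝 0) := by
    refine squeeze_zero_norm (fun n => ?_) (hℓ0 i)
    rw [Real.norm_eq_abs]
    exact abs_sub_cornerPt_le (hℓ n) x i
  have := (tendsto_const_nhds (x := x i)).sub h0
  simpa using this

/-- A product of coordinatewise-integrable envelopes is integrable on `ℝ^ι` (Fubini). [folklore] -/
theorem integrable_prodEnvelope {E : ℝ → ℝ} (hE : Integrable E) : Integrable (fun x : ι → ℝ => ∏ i, E (x i)) := by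
  have h := Integrable.fintype_prod (ι := ι) (f := fun _ : ι => E) (μ := fun _ => volume) (fun _ => hE)
  rw [← MeasureTheory.volume_pi] at h
  exact h

/-- ★★★ **Riemann sums of a continuous function with a product envelope.**  Let `h : ℝ^ι → ℝ` be continuous with `|h(y)| ≤ C·Π_i e(y_i)`, `C, e ≥ 0`, and let `E : ℝ → ℝ` be
an integrable WINDOW MAJORANT: `e(s) ≤ E(t)` whenever `|s − t| ≤ δ`.  Then along any meshes `0 < ℓ_{n,i} ≤ δ` with `ℓ_{n,i} → 0` for every `i`:
`Σ_{k∈ℤ^ι} (Π_iℓ_{n,i})·h(ℓ_n ⊙ k) → ∫_{ℝ^ι} h`. [folklore] -/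
theorem tendsto_latticeSum_continuous (h : (ι → ℝ) → ℝ) (hc : Continuous h) {C : ℝ} (hC : 0 ≤ C) {e E : ℝ → ℝ} (he0 : ∀ s, 0 ≤ e s) {δ : ℝ}
    (hwin : ∀ s t, |s - t| ≤ δ → e s ≤ E t) (hE : Integrable E) (hdom : ∀ y, |h y| ≤ C * ∏ i, e (y i))
    (ℓ : ℕ → ι → ℝ) (hℓ : ∀ n i, 0 < ℓ n i) (hℓδ : ∀ n i, ℓ n i ≤ δ) (hℓ0 : ∀ i, Tendsto (fun n => ℓ n i) atTop (𝓝 0)) :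
    Tendsto (fun n => ∑' b, (∏ i, ℓ n i) * h (cornerPt (ℓ n) b)) atTop (𝓝 (∫ x, h x)) := by
  refine tendsto_latticeSum_of_dominated ℓ hℓ (fun n b => h (cornerPt (ℓ n) b)) h (fun x => C * ∏ i, E (x i))
    ((integrable_prodEnvelope hE).const_mul C) ?_ ?_
  · intro n x
    refine (hdom _).trans (mul_le_mul_of_nonneg_left (Finset.prod_le_prod (fun i _ => he0 _) fun i _ => hwin _ _ ?_) hC)
    rw [abs_sub_comm]
    exact (abs_sub_cornerPt_le (hℓ n) x i).trans (hℓδ n i)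
  · intro x
    exact (hc.tendsto x).comp (tendsto_cornerPt ℓ hℓ hℓ0 x)

end Summit.QuantumFields.YangMills.BalabanUVNodes.N15KingModelRung.LatticeRiemann

end
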